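import Summits.HodgeConjecture.HodgeConjecture.Theses.GenericDivisibility
import Summits.HodgeConjecture.HodgeConjecture.Theorems.GenericDivisibilityHodgeBoundedSuffices
import Summits.HodgeConjecture.HodgeConjecture.Theorems.GenericDivisibilityDivisorInduction
import Summits.HodgeConjecture.HodgeConjecture.Theorems.GenericDivisibilityPencilReduction
import Summits.HodgeConjecture.HodgeConjecture.Theorems.GenericDivisibilityHardLefschetzReduction
import Summits.HodgeConjecture.HodgeConjecture.Theorems.GenericDivisibilityHodgeModelsExist
import Summits.HodgeConjecture.HodgeConjecture.Theorems.GenericDivisibilityHodgeClassesGenericallyDivisibleStubModularConiveauOfDivisible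
import Summits.HodgeConjecture.HodgeConjecture.Theorems.GenericDivisibilityHodgeClassesGenericallyDivisibleStubOnePrimePrinciple
import Summits.HodgeConjecture.HodgeConjecture.Theorems.GenericDivisibilityHodgeClassesGenericallyDivisibleStubMultipleSupportedComplexSupported
import Literature.AlgebraicGeometry.HodgeTheory.LefschetzOneOneHolds
import Literature.AlgebraicGeometry.Motives.UnramifiedCohomology
import HarnessLib

/-!
# STRATEGY-CENSUS companion (generation 1, wall-breaker) — crux `HodgeClassesGenericallyDivisible`
(C1, item stmt-HodgeConjecture-18466, route `GenericDivisibility`)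

Typed signatures and kernel-checked structural facts quoted in `STRATEGY-CENSUS.md` (generation 1,
unit `cstrat-stmt-HodgeConjecture-18466-p1`, 2026-08-17).  No `sorry`.  Everything is stated over the
route's own declarations and the landed `Theorems/GenericDivisibility*.lean`.

Contents.
* `CruxAt p₀` (C1 at one half-dimension) and `crux_iff_forall_cruxAt`.
* **Structural theorem** `crux_iff_hodgeConjecture_of_bounded`: granted the route's Hodge-free crux C2
  (`GenericDivisibilityBounded`) and its support item `TorsionDiesGenerically` (CT–Voisin 2012
  Thm. 3.1), C1 is *equivalent* to the Hodge conjecture.  (Corollary of the provers'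
  `genericDivisibility_hodgeConjecture_iff_of_torsionDiesGenerically`.)  This is the formal content of
  the verdict "no strategy short of the summit": relative to the route's other crux, C1 IS the summit.
* **Decomposition D6** (the inductive restatement recommended by the generation-0 census §8 as
  "the cheap enabling move"): `CruxStepAt p₀ := HCBelow (2 p₀) → CruxAt p₀`, the glue
  `crux_of_cruxStep_of_bounded : GenericDivisibilityBounded → CruxStep → C1` (and
  `hodgeConjecture_of_cruxStep_of_bounded`) PROVED by the route's own dimension induction with
  pointwise seam — so D6 is a genuine typed decomposition `C1 ⇐ CruxStep ∧ C2` — together with the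
  kernel-checked reason it is NOT filed: `cruxStepAt_two_iff` — at the first open rung `p₀ = 2` the
  added hypothesis (HC in dimension `≤ 3`) is a theorem of the tree, so `CruxStepAt 2 ↔ CruxAt 2`:
  no teeth where every open instance lives.
* `PhantomFinite ℓ` (PF, BARRIER-NOTES-ideator4-r2 §B4), typed over `coniveauFiltration`, and B4's claim
  PROVED: `genericDivisibilityBounded_of_phantomFinite` (PF at ONE prime ⇒ the route's Hodge-free crux
  C2 — pointer for the C2 seats), `supported_of_phantomFinite_of_cruxAt` (under PF_ℓ the rung of C1
  at the powers of ℓ alone forces rational coniveau one), `hodgeConjecture_of_phantomFinite_of_crux`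
  and `crux_iff_hodgeConjecture_of_phantomFinite` (PF_ℓ ⊢ C1 ↔ HC granted `TorsionDiesGenerically`):
  wherever phantom finiteness holds, C1 has no content short of the summit.
-/

set_option linter.dupNamespace false

noncomputable section

namespace Summit.HodgeConjecture.HodgeConjecture.Cruxes.HodgeClassesGenericallyDivisible.CensusGen1

open CategoryTheory AlgebraicGeometry
open Literature.AlgebraicGeometry.Motives Literature.AlgebraicGeometry.HodgeTheory
  Literature.AlgebraicTopology.SingularHomology
open Summit.HodgeConjecture.HodgeConjecture.Theses.GenericDivisibility
open Summit.HodgeConjecture.HodgeConjecture.Theorems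

/-! ### C1 rung by rung -/

/-- C1 at one half-dimension `p₀`: the crux restricted to smooth projective `2p₀`-folds. -/
def CruxAt (p₀ : ℕ) : Prop :=
  ∀ ⦃X : SchemeOver ℂ⦄, 1 ≤ p₀ → IsSmoothProjective (2 * p₀) X →
    ∀ z : singularCohomology ℤ ℤ (ComplexPoints X) (2 * p₀),
      IsOfHodgeType (2 * p₀) X (2 * p₀) p₀ p₀
        (singularCohomology.ringChange (Int.castRingHom ℂ) (ComplexPoints X) (2 * p₀) z) →
      ∀ m : ℕ, 1 ≤ m → ∃ Z : Set X.left, IsClosed Z ∧ Z ≠ Set.univ ∧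
        ∃ y : singularCohomology ℤ ℤ (complexPointsCompl X Z) (2 * p₀),
          m • y = singularCohomology.map ℤ ℤ
            (⟨Subtype.val, continuous_subtype_val⟩ : C(complexPointsCompl X Z, ComplexPoints X))
            (2 * p₀) z

/-- C1 is the conjunction of its rungs. -/
theorem crux_iff_forall_cruxAt : HodgeClassesGenericallyDivisible ↔ ∀ p₀, CruxAt p₀ :=
  ⟨fun h _ _ hp hX ↦ h hp hX, fun h _ _ hp hX ↦ h _ hp hX⟩

/-! ### The structural theorem: relative to C2, C1 is the Hodge conjecture -/

/-- **Granted the route's Hodge-free crux C2 and its support item `TorsionDiesGenerically`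
(Colliot-Thélène–Voisin 2012, Thm. 3.1), C1 ↔ HodgeConjecture.**  Forward: C2 ⇒ C2_Hdg
(`genericDivisibilityBounded_imp_hodgeBounded`) and C1 ∧ C2_Hdg ⇒ HC
(`genericDivisibility_hodgeConjecture_of_hodgeBounded`, unconditional); backward: HC ⇒ C1 granted
`TorsionDiesGenerically` (`genericDivisibility_hodgeConjecture_iff_of_torsionDiesGenerically`).
Consequence for strategy: every proof of C1 is, in the presence of C2, a proof of the Hodge
conjecture; C1 can be easier than HC only in a world where C2 fails (an infinite phantom tower),
which is the route's own kill criterion. [cite: ColliotTheleneVoisin2012, §3 Thm. 3.1] -/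
theorem crux_iff_hodgeConjecture_of_bounded (hT : TorsionDiesGenerically)
    (h2 : GenericDivisibilityBounded) :
    HodgeClassesGenericallyDivisible ↔ _root_.HodgeConjecture :=
  ⟨fun h1 ↦ (genericDivisibility_hodgeConjecture_iff_of_torsionDiesGenerically hT).2
      ⟨h1, genericDivisibilityBounded_imp_hodgeBounded h2⟩,
    fun hHC ↦ ((genericDivisibility_hodgeConjecture_iff_of_torsionDiesGenerically hT).1 hHC).1⟩

/-- The unconditional half, recorded separately: C1 ∧ C2 ⇒ HC needs no named fact at all. -/
theorem hodgeConjecture_of_crux_of_bounded (h1 : HodgeClassesGenericallyDivisible)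
    (h2 : GenericDivisibilityBounded) : _root_.HodgeConjecture :=
  genericDivisibility_hodgeConjecture_of_hodgeBounded h1 (genericDivisibilityBounded_imp_hodgeBounded h2)

/-! ### Decomposition D6: the inductive restatement, its proved glue, and why it is not filed -/

/-- The Hodge conjecture for all smooth projective complex varieties of dimension `< M`. -/
def HCBelow (M : ℕ) : Prop :=
  ∀ ⦃n : ℕ⦄, n < M → ∀ ⦃Y : SchemeOver ℂ⦄, IsSmoothProjective n Y → HodgeConjectureFor n Y

/-- **D6, the inductive restatement of the rung `p₀`**: C1 on `2p₀`-folds GRANTED the Hodge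
conjecture for every smooth projective variety of dimension `< 2p₀` (the induction hypothesis that
the route's `closes` has in hand when it consumes the rung). -/
def CruxStepAt (p₀ : ℕ) : Prop := HCBelow (2 * p₀) → CruxAt p₀

/-- D6 for all rungs. -/
def CruxStep : Prop := ∀ p₀, CruxStepAt p₀

/-- The restatement only adds a hypothesis. -/
theorem cruxStep_of_crux (h : HodgeClassesGenericallyDivisible) : CruxStep :=
  fun p₀ _ ↦ crux_iff_forall_cruxAt.1 h p₀

/-- HC below dimension `4` is a theorem of the tree (Lefschetz (1,1) + hard Lefschetz for
threefolds). [cite: VoisinHodgeII2003, §10.2.3 proof of Prop. 10.26] -/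
theorem hcBelow_four : HCBelow 4 :=
  fun _ hn _ hY ↦ hodgeConjectureFor_of_dim_le_three_holds (by omega) hY

/-- **No teeth at the first open rung.**  At `p₀ = 2` (fourfolds, where every first open instance of
C1 lives: K3 × K3 with real multiplication, hyper-Kähler fourfolds, Calabi–Yau and general-type
fourfolds; Weil sixfolds are `p₀ = 3`) the hypothesis of the inductive restatement is the theorem
`hcBelow_four`, so `CruxStepAt 2` is `CruxAt 2` verbatim.  This is why D6 is recorded, glue and all,
but NOT filed as a route split. [cite: VoisinHodgeII2003, §10.2.3] -/
theorem cruxStepAt_two_iff : CruxStepAt 2 ↔ CruxAt 2 :=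
  ⟨fun h ↦ h hcBelow_four, fun h _ ↦ h⟩

/-- Likewise at `p₀ = 1` (where C1 is the integral Lefschetz (1,1) theorem anyway). -/
theorem cruxStepAt_one_iff : CruxStepAt 1 ↔ CruxAt 1 :=
  ⟨fun h ↦ h fun _ hn _ hY ↦ hodgeConjectureFor_of_dim_le_three_holds (by omega) hY, fun h _ ↦ h⟩

/-- Pointwise seam (the proof of item stmt-HodgeConjecture-18468 run at one rung): the rung `p` of
C1 and C2 give coniveau `≥ 1` for every rational middle `(p,p)` class on every `2p`-fold.
[cite: VoisinHodgeI2002, §7.1.1] [cite: HatcherAT2002, §3.1 Thm. 3.2] -/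
theorem middleConiveauOne_at {p : ℕ} (h1 : CruxAt p) (h2 : GenericDivisibilityBounded)
    ⦃X : SchemeOver ℂ⦄ (hp : 1 ≤ p) (hX : IsSmoothProjective (2 * p) X)
    (c : complexBetti X (2 * p)) (hc : IsRationalClass c)
    (hpp : IsOfHodgeType (2 * p) X (2 * p) p p c) : c ∈ supportedClasses X (2 * p) 1 := by
  obtain ⟨N, hN, hNc⟩ := hc.exists_nsmul_isIntegralClass hX
  obtain ⟨z, hz⟩ := (isIntegralClass_iff_mem_range_ringChange _).1 hNc
  have hzpp : IsOfHodgeType (2 * p) X (2 * p) p p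
      (singularCohomology.ringChange (Int.castRingHom ℂ) (ComplexPoints X) (2 * p) z) := by
    rw [hz]
    obtain ⟨A, hA⟩ := hpp
    exact ⟨A, by rw [map_smul]; exact Submodule.smul_mem _ _ hA⟩
  have hmem : singularCohomology.ringChange (Int.castRingHom ℂ) (ComplexPoints X) (2 * p) z ∈
      supportedClasses X (2 * p) 1 :=
    h2 hp hX z (h1 hp hX z hzpp)
  rw [hz] at hmem
  have hN' : (N : ℂ) ≠ 0 := Nat.cast_ne_zero.2 hN.ne'
  have hc' : (N : ℂ)⁻¹ • ((N : ℂ) • c) ∈ supportedClasses X (2 * p) 1 :=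
    Submodule.smul_mem _ _ hmem
  rwa [smul_smul, inv_mul_cancel₀ hN', one_smul] at hc'

/-- **The glue of D6 runs**: C2 and the inductive restatement give the Hodge conjecture below every
dimension — the route's `closes` induction (Hodge models, pencil reduction below the middle, hard
Lefschetz above it, divisor induction in the middle; all four engines are PROVED route items) with
the rung `CruxAt p` extracted from `CruxStepAt p` and the induction hypothesis.
[cite: Thomas2005Nodes, Thm. 1 and §2 Prop. 2] [cite: DecataldoMigliorini2009, §4 Prop. 4.5] -/
theorem hcBelow_of_cruxStep_of_bounded (h2 : GenericDivisibilityBounded) (hS : CruxStep) :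
    ∀ M, HCBelow M := by
  have hM : HodgeModelsExist := genericDivisibility_hodgeModelsExist_proof
  have hDiv : DivisorInduction := genericDivisibility_divisorInduction_proof
  have hP : PencilReduction := genericDivisibility_pencilReduction_proof
  have hHL : HardLefschetzReduction := genericDivisibility_hardLefschetzReduction_proof
  intro M
  induction M with
  | zero => intro n hn; exact absurd hn (Nat.not_lt_zero n)
  | succ M ih =>
    intro n hn X hX
    have zc : ∀ k, k = 0 → ∀ c' : complexBetti X (2 * k), c' ∈ algebraicClasses X k := by
      rintro k rfl c'
      exact hodgeConjectureFor_codim_zero c'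
    have below : ∀ (k : ℕ), 2 * k < n → ∀ c' : complexBetti X (2 * k), IsRationalClass c' →
        IsOfHodgeType n X (2 * k) k k c' → c' ∈ algebraicClasses X k := by
      cases n with
      | zero => intro k hk; exact absurd hk (Nat.not_lt_zero _)
      | succ m =>
        have gen : ∀ k, 2 * k ≤ m → ∀ ⦃X' : SchemeOver ℂ⦄, IsSmoothProjective (m + 1) X' →
            ∀ c' : complexBetti X' (2 * k), IsRationalClass c' →
              IsOfHodgeType (m + 1) X' (2 * k) k k c' → c' ∈ algebraicClasses X' k := by
          intro k
          induction k using Nat.strong_induction_on with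
          | _ k ihk =>
            intro hkm X' hX' c' hc' hpp'
            rcases Nat.eq_zero_or_pos k with rfl | hk
            · exact hodgeConjectureFor_codim_zero c'
            · exact hP m k hk hkm (fun Y hY q d hd hqq => (ih (by omega) hY).2 q d hd hqq)
                (fun X'' hX'' d hd hqq => ihk (k - 1) (by omega) (by omega) hX'' d hd hqq)
                hX' c' hc' hpp'
        intro k hk c' hc' hpp'
        exact gen k (by omega) hX c' hc' hpp'
    have lowdeg : ∀ k, (2 * k < n ∨ k = 0) → ∀ c' : complexBetti X (2 * k), IsRationalClass c' →
        IsOfHodgeType n X (2 * k) k k c' → c' ∈ algebraicClasses X k := by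
      intro k hk c' hc' hpp'
      rcases hk with hk | hk
      · exact below k hk c' hc' hpp'
      · exact zc k hk c'
    refine ⟨hM n X hX, fun p c hc hpp => ?_⟩
    rcases Nat.lt_trichotomy (2 * p) n with hlt | heq | hgt
    · exact below p hlt c hc hpp
    · cases n with
      | zero => exact zc p (by omega) c
      | succ m =>
        have hp : 1 ≤ p := by omega
        have hX2 := hX
        have hpp2 := hpp
        rw [← heq] at hX2 hpp2
        -- the rung `CruxAt p` from the restatement and the induction hypothesis below `2p = n`
        have h1 : CruxAt p := hS p fun n' hn' Y hY ↦ ih (by omega) hY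
        have hsupp : c ∈ supportedClasses X (2 * p) 1 := middleConiveauOne_at h1 h2 hp hX2 c hc hpp2
        exact hDiv m p hp (fun Y hY d hd hqq => (ih (by omega) hY).2 (p - 1) d hd hqq) hX c hc hpp
          hsupp
    · exact hHL n p hgt hX (lowdeg (n - p) (by omega)) c hc hpp

/-- **D6 glue, summit form**: C2 ∧ CruxStep ⇒ HodgeConjecture. -/
theorem hodgeConjecture_of_cruxStep_of_bounded (h2 : GenericDivisibilityBounded) (hS : CruxStep) :
    _root_.HodgeConjecture :=
  fun n _ hX ↦ hcBelow_of_cruxStep_of_bounded h2 hS (n + 1) (Nat.lt_succ_self n) hX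

/-- **D6 glue, crux form** (the typed split `C1 ⇐ CruxStep ∧ C2`, proved): no named fact used. -/
theorem crux_of_cruxStep_of_bounded (h2 : GenericDivisibilityBounded) (hS : CruxStep) :
    HodgeClassesGenericallyDivisible :=
  crux_iff_forall_cruxAt.2 fun p₀ ↦ hS p₀ fun _ hn _ hY ↦
    hcBelow_of_cruxStep_of_bounded h2 hS (2 * p₀) hn hY

/-! ### PF — phantom finiteness (BARRIER-NOTES-ideator4-r2 §B4), typed, and what it does to the route -/

/-- **Phantom finiteness at the prime `ℓ`** (Hodge-free): on every smooth projective `2p`-fold there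
is `c` such that a mod-`ℓ^{r+c}` class of coniveau `≥ 1` is, modulo `ℓ^r · H`, an INTEGRAL class of
coniveau `≥ 1` (`coniveauFiltration ℤ X (2p) 1`: dies on a non-empty Zariski open) — the phantom
module `(lim_r N¹H(ℤ/ℓʳ)) / (N¹_ℤ ⊗ ℤ_ℓ)` is killed by `ℓᶜ`.  [cite: BlochEsnault1996, p. 305]
[cite: ColliotTheleneVoisin2012, §3] -/
def PhantomFinite (ℓ : ℕ) : Prop :=
  ∀ ⦃p : ℕ⦄ ⦃X : SchemeOver ℂ⦄, 1 ≤ p → IsSmoothProjective (2 * p) X →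
    ∃ c : ℕ, ∀ (r : ℕ) (x : singularCohomology ℤ ℤ (ComplexPoints X) (2 * p)),
      singularCohomology.ringChange (Int.castRingHom (ZMod (ℓ ^ (r + c)))) (ComplexPoints X) (2 * p)
          x ∈ coniveauFiltration (ZMod (ℓ ^ (r + c))) X (2 * p) 1 →
        ∃ w ∈ coniveauFiltration ℤ X (2 * p) 1,
          ∃ v : singularCohomology ℤ ℤ (ComplexPoints X) (2 * p), x = w + (ℓ ^ r) • v

/-- **Under PF at ONE prime, generic divisibility by the powers of that prime alone already forces
rational coniveau one** (no Hodge type, no C2): divisible by `ℓ^{r+c}` on an open ⇒ mod-`ℓ^{r+c}`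
coniveau one (`stub_modularConiveau_of_divisible`, landed) ⇒ by PF `z ≡ N¹_ℤ mod ℓʳ` for every `r`
⇒ one-prime principle (`stub_onePrimePrinciple`, landed: Krull in the f.g. quotient `H/N¹_ℤ`) ⇒
`N • z ∈ N¹_ℤ` ⇒ `z ⊗ ℂ ∈ N¹` (`stub_multipleSupportedComplexSupported`, landed).
[cite: ColliotTheleneVoisin2012, §3] [cite: BlochOgus1974ENS, (3.8)] -/
theorem supported_of_phantomFinite_of_divisible_pow {ℓ : ℕ} (hℓ : ℓ.Prime) (hPF : PhantomFinite ℓ)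
    ⦃p : ℕ⦄ ⦃X : SchemeOver ℂ⦄ (hp : 1 ≤ p) (hX : IsSmoothProjective (2 * p) X)
    (z : singularCohomology ℤ ℤ (ComplexPoints X) (2 * p))
    (hdiv : ∀ r : ℕ, ∃ Z : Set X.left, IsClosed Z ∧ Z ≠ Set.univ ∧
      ∃ y : singularCohomology ℤ ℤ (complexPointsCompl X Z) (2 * p),
        (ℓ ^ r) • y = restrictToCompl ℤ X (2 * p) Z z) :
    singularCohomology.ringChange (Int.castRingHom ℂ) (ComplexPoints X) (2 * p) z ∈
      supportedClasses X (2 * p) 1 := by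
  haveI := hX.geometricallyIrreducible
  haveI : IrreducibleSpace X.left :=
    AlgebraicGeometry.GeometricallyIrreducible.irreducibleSpace_of_subsingleton X.hom
  obtain ⟨c, hc⟩ := hPF hp hX
  have key : ∀ k : ℕ, ∃ y ∈ coniveauFiltration ℤ X (2 * p) 1,
      ∃ w : singularCohomology ℤ ℤ (ComplexPoints X) (2 * p), z = y + (ℓ ^ k) • w :=
    fun k ↦ hc k z (stub_modularConiveau_of_divisible (2 * p) (ℓ ^ (k + c)) z (hdiv (k + c)))
  obtain ⟨N, hN, -, hmem⟩ := stub_onePrimePrinciple hX (2 * p) z ℓ hℓ key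
  exact stub_multipleSupportedComplexSupported (2 * p) z N hN hmem

/-- **PF at one prime implies the route's Hodge-free crux C2** (`GenericDivisibilityBounded`,
item stmt-HodgeConjecture-18467): PF is "C2 at one prime, with an effective exponent". -/
theorem genericDivisibilityBounded_of_phantomFinite {ℓ : ℕ} (hℓ : ℓ.Prime) (hPF : PhantomFinite ℓ) :
    GenericDivisibilityBounded := by
  intro p X hp hX z hdiv
  exact supported_of_phantomFinite_of_divisible_pow hℓ hPF hp hX z fun r ↦
    hdiv (ℓ ^ r) (Nat.one_le_pow r ℓ hℓ.pos)

/-- **Under PF at one prime, the crux C1 is summit-equivalent on its own**: PF_ℓ ∧ C1 ⇒ HC (by the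
previous theorem and `hodgeConjecture_of_crux_of_bounded`), while HC ⇒ C1 granted
`TorsionDiesGenerically`.  This is BARRIER-NOTES §B4's claim as a theorem: wherever phantom
finiteness holds, C1 has no content short of the Hodge conjecture and deserves no separate staffing.
[cite: ColliotTheleneVoisin2012, §3 Thm. 3.1] -/
theorem hodgeConjecture_of_phantomFinite_of_crux {ℓ : ℕ} (hℓ : ℓ.Prime) (hPF : PhantomFinite ℓ)
    (h1 : HodgeClassesGenericallyDivisible) : _root_.HodgeConjecture :=
  hodgeConjecture_of_crux_of_bounded h1 (genericDivisibilityBounded_of_phantomFinite hℓ hPF)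

/-- The `iff` form: granted PF at one prime and `TorsionDiesGenerically`, C1 ↔ HC. -/
theorem crux_iff_hodgeConjecture_of_phantomFinite {ℓ : ℕ} (hℓ : ℓ.Prime) (hPF : PhantomFinite ℓ)
    (hT : TorsionDiesGenerically) : HodgeClassesGenericallyDivisible ↔ _root_.HodgeConjecture :=
  crux_iff_hodgeConjecture_of_bounded hT (genericDivisibilityBounded_of_phantomFinite hℓ hPF)

/-- **Rung form without the Hodge type**: under PF_ℓ, C1 at the rung `p` restricted to the powers of
`ℓ` already gives rational coniveau one for the class — the pointwise statement behind S⁺₉. -/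
theorem supported_of_phantomFinite_of_cruxAt {ℓ : ℕ} (hℓ : ℓ.Prime) (hPF : PhantomFinite ℓ)
    {p : ℕ} (h1 : CruxAt p) ⦃X : SchemeOver ℂ⦄ (hp : 1 ≤ p) (hX : IsSmoothProjective (2 * p) X)
    (z : singularCohomology ℤ ℤ (ComplexPoints X) (2 * p))
    (hz : IsOfHodgeType (2 * p) X (2 * p) p p
      (singularCohomology.ringChange (Int.castRingHom ℂ) (ComplexPoints X) (2 * p) z)) :
    singularCohomology.ringChange (Int.castRingHom ℂ) (ComplexPoints X) (2 * p) z ∈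
      supportedClasses X (2 * p) 1 :=
  supported_of_phantomFinite_of_divisible_pow hℓ hPF hp hX z fun r ↦
    h1 hp hX z hz (ℓ ^ r) (Nat.one_le_pow r ℓ hℓ.pos)

end Summit.HodgeConjecture.HodgeConjecture.Cruxes.HodgeClassesGenericallyDivisible.CensusGen1

end
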